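import Summits.QuantumFields.YangMills.Theses.BoundedSkewnessRunning

/-!
# Dilation covariance of the crux's lattice `n`-point functions (negative-side lemmas for K2)

Supporting lemmas for the refuter analysis of `BoundedSkewnessRunning.SkewnessNonGeneration`
(item `stmt-QuantumFields-19896`; full findings in
`Summits/QuantumFields/YangMills/Cruxes/SkewnessNonGeneration/Disproof.lean`).  No statement here
asserts a Theses decl positively.

* `smearedLatticeField_dilate`: respacing `a ↦ s a` is undone by dilating the test function and
  rescaling the multiplicative constant by `s⁻⁴` — pointwise in the gauge field.
* `latticeSchwinger_cruxBare_companion`, `cruxT_companion`: for two schemes with the same couplings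
  and volumes and `a'_k = s a_k`, bare `n`-point functions scale by `s^{-4n}`, `T_k` by `s⁻⁸`.
* `latticeSchwinger_cruxCanon_companion`, `cruxKappa3_companion`: the SELF-NORMALISED `n`-point
  functions and the skewness `κ₃^canon` are exactly dilation invariant.
* `tendsto_cruxKappa3_of_constRatio` (load-bearing analysis of K2): a constant-ratio companion is
  idle — extinction along `sch'` alone gives extinction along `sch`, with no gap / window / weak
  coupling / `a ≤ a'` used; all content of K2 is the regime `a_k / a'_k → 0`.
* `cruxKappa3_eq_zero_of_cruxT_nonpos` (boundary): `T_k(u) ≤ 0 ⇒ κ₃^canon_k = 0`.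
-/

noncomputable section

open scoped SchwartzMap Topology BigOperators
open MeasureTheory Filter Set
open Literature.MathematicalPhysics.AQFT Literature.MathematicalPhysics.QuantumLattice
open Literature.MathematicalPhysics.QuantumFieldTheory
open Summit.QuantumFields.YangMills.Theorems.SelfNormalisedSkewness.Negative

namespace Summit.QuantumFields.YangMills.Theorems.SkewnessNonGeneration.Negative

section Smeared

variable {G : Type} [MeasurableSpace G]

/-- Respacing a smeared lattice field (`a' = s a`): `Φ_{a}^{c,m}(f) = Φ_{sa}^{c s⁻⁴, m}(D_s f)` with
`(D_s f)(y) = f (s⁻¹ y)` the tree's `dilateTest`. Pointwise in the gauge field, pure algebra. [folklore] -/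
theorem smearedLatticeField_dilate (O : LGConfig 4 G → ℝ)
    (Λ : Finset (Literature.Probability.LatticeModels.Site 4)) (a c m : ℝ) {s : ℝ} (hs : s ≠ 0)
    (f : 𝓢(E4, ℝ)) (U : LGConfig 4 G) :
    smearedLatticeField O Λ a c m f U =
      smearedLatticeField O Λ (s * a) (c * (s ^ 4)⁻¹) m (dilateTest s hs f) U := by
  unfold smearedLatticeField
  have h4 : s ^ 4 ≠ 0 := pow_ne_zero 4 hs
  have hpt : ∀ x ∈ Λ, (dilateTest s hs f) ((s * a) • siteToE x) = f (a • siteToE x) := by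
    intro x _
    rw [dilateTest_apply, smul_smul, ← mul_assoc, inv_mul_cancel₀ hs, one_mul]
  have hsum : ∑ x ∈ Λ, (dilateTest s hs f) ((s * a) • siteToE x) * (O (configShift (-x) U) - m)
      = ∑ x ∈ Λ, f (a • siteToE x) * (O (configShift (-x) U) - m) :=
    Finset.sum_congr rfl (fun x hx => by rw [hpt x hx])
  rw [hsum, mul_pow]
  field_simp

/-- The multiplicative renormalisation is an overall factor. [folklore] -/
theorem smearedLatticeField_eq_mul_one (O : LGConfig 4 G → ℝ)
    (Λ : Finset (Literature.Probability.LatticeModels.Site 4)) (a c m : ℝ)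
    (f : 𝓢(E4, ℝ)) (U : LGConfig 4 G) :
    smearedLatticeField O Λ a c m f U = c * smearedLatticeField O Λ a 1 m f U := by
  unfold smearedLatticeField; ring

/-- With renormalisation constant `0` the smeared field vanishes. [folklore] -/
theorem smearedLatticeField_zero_const (O : LGConfig 4 G → ℝ)
    (Λ : Finset (Literature.Probability.LatticeModels.Site 4)) (a m : ℝ) (f : 𝓢(E4, ℝ))
    (U : LGConfig 4 G) : smearedLatticeField O Λ a 0 m f U = 0 := by
  unfold smearedLatticeField; ring

end Smeared

/-- Dilation commutes with time reflection on test functions. [folklore] -/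
theorem dilateTest_thetaTest {s : ℝ} (hs : s ≠ 0) (w : 𝓢(E4, ℝ)) :
    dilateTest s hs (thetaTest 4 w) = thetaTest 4 (dilateTest s hs w) := by
  ext x
  simp only [dilateTest_apply, thetaTest_apply, map_smul]

variable {G : Type} [Group G] [TopologicalSpace G] [IsTopologicalGroup G] [CompactSpace G]
  [MeasurableSpace G] [BorelSpace G]

/-- **Dilation covariance of the bare lattice `n`-point functions.** For two schemes with the same
couplings `β_k` and volumes `L_k` (hence the same lattice Gibbs measures) and spacings `a'_k = s a_k`
at step `k`, the bare `n`-point function of `sch` at `f₁,…,fₙ` is `s^{-4n}` times that of `sch'` at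
the dilated test functions `D_s fᵢ`. [folklore] -/
theorem latticeSchwinger_cruxBare_companion {N : ℕ} (ρ : G →* Matrix (Fin N) (Fin N) ℂ)
    (obs : YMSpecies G → LGConfig 4 G → ℝ) {sch sch' : SpeciesScheme (YMSpecies G)}
    (hβ : sch'.β = sch.β) (hL : sch'.L = sch.L) (k n : ℕ) {s : ℝ} (hs : s ≠ 0)
    (hsk : sch'.a k = s * sch.a k) (σ : Fin n → YMSpecies G) (f : Fin n → 𝓢(E4, ℝ)) :
    latticeSchwinger ρ (cruxBare sch) obs k n σ f =
      ((s ^ 4)⁻¹) ^ n * latticeSchwinger ρ (cruxBare sch') obs k n σ (fun i => dilateTest s hs (f i)) := by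
  obtain ⟨a', ha'pos, ha't, β', L', hL't, c', m'⟩ := sch'
  simp only at hβ hL hsk
  subst hβ hL
  unfold latticeSchwinger cruxBare
  simp only [SpeciesScheme.side]
  rw [← integral_const_mul]
  refine integral_congr_ae (ae_of_all _ fun U => ?_)
  dsimp only
  rw [hsk]
  have hfac : ∀ i : Fin n,
      smearedLatticeField (obs (σ i)) (Literature.Probability.LatticeModels.box 4 (sch.L k)) (sch.a k) 1 0
          (f i) (torusLift (2 * sch.L k + 1) U) =
        (s ^ 4)⁻¹ * smearedLatticeField (obs (σ i)) (Literature.Probability.LatticeModels.box 4 (sch.L k))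
          (s * sch.a k) 1 0 (dilateTest s hs (f i)) (torusLift (2 * sch.L k + 1) U) := by
    intro i
    rw [smearedLatticeField_dilate (obs (σ i)) _ (sch.a k) 1 0 hs (f i), one_mul,
      smearedLatticeField_eq_mul_one _ _ _ ((s ^ 4)⁻¹)]
  rw [Finset.prod_congr rfl fun i _ => hfac i, Finset.prod_mul_distrib, Finset.prod_const,
    Finset.card_univ, Fintype.card_fin]

/-- **Dilation covariance of the crux's two-point function** `T_k`: `T_k^{sch}(w) = s⁻⁸ T_k^{sch'}(D_s w)`. [folklore] -/
theorem cruxT_companion (r : LatticeRep G) {sch sch' : SpeciesScheme (YMSpecies G)}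
    (hβ : sch'.β = sch.β) (hL : sch'.L = sch.L) (k : ℕ) {s : ℝ} (hs : s ≠ 0)
    (hsk : sch'.a k = s * sch.a k) (w : 𝓢(E4, ℝ)) :
    cruxT r sch w k = (s ^ 8)⁻¹ * cruxT r sch' (dilateTest s hs w) k := by
  unfold cruxT
  rw [latticeSchwinger_cruxBare_companion r.ρ _ hβ hL k (1 + 1) hs hsk,
    latticeSchwinger_cruxBare_companion r.ρ _ hβ hL k 1 hs hsk,
    latticeSchwinger_cruxBare_companion r.ρ _ hβ hL k 1 hs hsk]
  have h2 : (fun i => dilateTest s hs (![w, thetaTest 4 w] i)) =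
      ![dilateTest s hs w, thetaTest 4 (dilateTest s hs w)] := by
    funext i
    fin_cases i
    · rfl
    · simp [dilateTest_thetaTest hs w]
  have h1 : (fun i => dilateTest s hs (![w] i)) = ![dilateTest s hs w] := by
    funext i; fin_cases i; rfl
  have h1' : (fun i => dilateTest s hs (![thetaTest 4 w] i)) = ![thetaTest 4 (dilateTest s hs w)] := by
    funext i; fin_cases i; simp [dilateTest_thetaTest hs w]
  rw [h2, h1, h1']
  ring


/-- The self-normalising constants match under dilation: `T^{-1/2} s⁻⁴ = (T')^{-1/2}`. [folklore] -/
theorem cruxCanon_const_companion (r : LatticeRep G) {sch sch' : SpeciesScheme (YMSpecies G)}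
    (hβ : sch'.β = sch.β) (hL : sch'.L = sch.L) (k : ℕ) {s : ℝ} (hs : s ≠ 0)
    (hsk : sch'.a k = s * sch.a k) (u : 𝓢(E4, ℝ)) :
    (Real.sqrt (cruxT r sch u k))⁻¹ * (s ^ 4)⁻¹ =
      (Real.sqrt (cruxT r sch' (dilateTest s hs u) k))⁻¹ := by
  have h4 : (0 : ℝ) < s ^ 4 := Even.pow_pos (by decide) hs
  have h8 : s ^ 8 = (s ^ 4) ^ 2 := by ring
  have hsq : Real.sqrt (cruxT r sch u k) =
      (s ^ 4)⁻¹ * Real.sqrt (cruxT r sch' (dilateTest s hs u) k) := by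
    rw [cruxT_companion r hβ hL k hs hsk u, Real.sqrt_mul (inv_nonneg.mpr (by positivity)),
      Real.sqrt_inv, h8, Real.sqrt_sq h4.le]
  rw [hsq, mul_inv, inv_inv, mul_comm (s ^ 4), mul_assoc, mul_inv_cancel₀ h4.ne', mul_one]

/-- **Companion covariance with running constants.** Schemes `{sch with c := c₁, m := m₁}` and
`{sch' with c := c₂, m := m₂}` (same couplings and volumes, `a'_k = s a_k`) have the SAME `n`-point
functions at dilated test data as soon as `c₁ s⁻⁴ = c₂` and `m₁ = m₂` at step `k`. [folklore] -/
theorem latticeSchwinger_with_companion {N : ℕ} (ρ : G →* Matrix (Fin N) (Fin N) ℂ)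
    (obs : YMSpecies G → LGConfig 4 G → ℝ) {sch sch' : SpeciesScheme (YMSpecies G)}
    (hβ : sch'.β = sch.β) (hL : sch'.L = sch.L) (k n : ℕ) {s : ℝ} (hs : s ≠ 0)
    (hsk : sch'.a k = s * sch.a k) (c₁ m₁ c₂ m₂ : YMSpecies G → ℕ → ℝ)
    (hc : ∀ sp, c₁ sp k * (s ^ 4)⁻¹ = c₂ sp k) (hm : ∀ sp, m₁ sp k = m₂ sp k)
    (σ : Fin n → YMSpecies G) (f : Fin n → 𝓢(E4, ℝ)) :
    latticeSchwinger ρ { sch with c := c₁, m := m₁ } obs k n σ f =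
      latticeSchwinger ρ { sch' with c := c₂, m := m₂ } obs k n σ
        (fun i => dilateTest s hs (f i)) := by
  obtain ⟨a', ha'pos, ha't, β', L', hL't, c', m'⟩ := sch'
  simp only at hβ hL hsk
  subst hβ hL
  unfold latticeSchwinger
  simp only [SpeciesScheme.side]
  refine integral_congr_ae (ae_of_all _ fun U => ?_)
  dsimp only
  rw [hsk]
  refine Finset.prod_congr rfl fun i _ => ?_
  rw [smearedLatticeField_dilate _ _ (sch.a k) _ _ hs (f i), hc (σ i), hm (σ i)]

/-- **The self-normalised `n`-point functions are dilation INVARIANT**: the canonical scheme built on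
`sch` at `(u; f₁,…,fₙ)` and the one built on the companion `sch'` at the dilated data give the same
numbers, step by step in `k`. [folklore] -/
theorem latticeSchwinger_cruxCanon_companion (r : LatticeRep G)
    {sch sch' : SpeciesScheme (YMSpecies G)} (hβ : sch'.β = sch.β) (hL : sch'.L = sch.L)
    (k n : ℕ) {s : ℝ} (hs : s ≠ 0) (hsk : sch'.a k = s * sch.a k) (u : 𝓢(E4, ℝ))
    (f : Fin n → 𝓢(E4, ℝ)) :
    latticeSchwinger r.ρ (cruxCanon r sch u) (fun s => s.F) k n (fun _ => r.curvature) f =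
      latticeSchwinger r.ρ (cruxCanon r sch' (dilateTest s hs u)) (fun s => s.F) k n
        (fun _ => r.curvature) (fun i => dilateTest s hs (f i)) := by
  have hc := cruxCanon_const_companion r hβ hL k hs hsk u
  obtain ⟨a', ha'pos, ha't, β', L', hL't, c', m'⟩ := sch'
  simp only at hβ hL hsk hc
  subst hβ hL
  exact latticeSchwinger_with_companion r.ρ (fun s => s.F) (sch := sch)
    (sch' := ⟨a', ha'pos, ha't, sch.β, sch.L, hL't, c', m'⟩) rfl rfl k n hs hsk _ _ _ _
    (fun _ => hc) (fun _ => rfl) (fun _ => r.curvature) f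

/-- **Dilation invariance of the self-normalised skewness** `κ₃^canon`: for a companion `sch'` with
the same couplings and volumes and `a'_k = s·a_k`,
`κ₃^canon_k[sch](u; f, g, h) = κ₃^canon_k[sch'](D_s u; D_s f, D_s g, D_s h)`. [folklore] -/
theorem cruxKappa3_companion (r : LatticeRep G) {sch sch' : SpeciesScheme (YMSpecies G)}
    (hβ : sch'.β = sch.β) (hL : sch'.L = sch.L) (k : ℕ) {s : ℝ} (hs : s ≠ 0)
    (hsk : sch'.a k = s * sch.a k) (u f g h : 𝓢(E4, ℝ)) :
    cruxKappa3 r sch u f g h k =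
      cruxKappa3 r sch' (dilateTest s hs u) (dilateTest s hs f) (dilateTest s hs g)
        (dilateTest s hs h) k := by
  have e1 : ∀ p : 𝓢(E4, ℝ), (fun i => dilateTest s hs (![p] i)) = ![dilateTest s hs p] := by
    intro p; funext i; fin_cases i; rfl
  have e2 : ∀ p q : 𝓢(E4, ℝ),
      (fun i => dilateTest s hs (![p, q] i)) = ![dilateTest s hs p, dilateTest s hs q] := by
    intro p q; funext i; fin_cases i <;> rfl
  have e3 : ∀ p q t : 𝓢(E4, ℝ), (fun i => dilateTest s hs (![p, q, t] i)) =
      ![dilateTest s hs p, dilateTest s hs q, dilateTest s hs t] := by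
    intro p q t; funext i; fin_cases i <;> rfl
  unfold cruxKappa3
  rw [latticeSchwinger_cruxCanon_companion r hβ hL k 3 hs hsk u ![f, g, h],
    latticeSchwinger_cruxCanon_companion r hβ hL k 2 hs hsk u ![g, h],
    latticeSchwinger_cruxCanon_companion r hβ hL k 2 hs hsk u ![f, h],
    latticeSchwinger_cruxCanon_companion r hβ hL k 2 hs hsk u ![f, g],
    latticeSchwinger_cruxCanon_companion r hβ hL k 1 hs hsk u ![f],
    latticeSchwinger_cruxCanon_companion r hβ hL k 1 hs hsk u ![g],
    latticeSchwinger_cruxCanon_companion r hβ hL k 1 hs hsk u ![h],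
    e3, e2, e2, e2, e1, e1, e1]

/-! ## Admissibility of dilated test data -/

section Admissible

/-- Unfolding the dilated test function as a function. [folklore] -/
theorem coe_dilateTest {s : ℝ} (hs : s ≠ 0) (f : 𝓢(E4, ℝ)) :
    ((dilateTest s hs f : 𝓢(E4, ℝ)) : E4 → ℝ) = fun x => f (s⁻¹ • x) :=
  funext fun x => dilateTest_apply s hs f x

/-- Dilation preserves compact support. [folklore] -/
theorem hasCompactSupport_dilateTest {s : ℝ} (hs : s ≠ 0) {f : 𝓢(E4, ℝ)}
    (hf : HasCompactSupport (f : E4 → ℝ)) :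
    HasCompactSupport ((dilateTest s hs f : 𝓢(E4, ℝ)) : E4 → ℝ) := by
  rw [coe_dilateTest]; exact hf.comp_smul (inv_ne_zero hs)

/-- `tsupport (D_s f) ⊆ (s⁻¹ • ·)⁻¹' tsupport f`. [folklore] -/
theorem tsupport_dilateTest_subset {s : ℝ} (hs : s ≠ 0) (f : 𝓢(E4, ℝ)) :
    tsupport ((dilateTest s hs f : 𝓢(E4, ℝ)) : E4 → ℝ) ⊆
      (fun x : E4 => s⁻¹ • x) ⁻¹' tsupport (f : E4 → ℝ) := by
  rw [coe_dilateTest]; exact tsupport_schwartz_comp_subset f (continuous_const_smul s⁻¹)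

/-- A POSITIVE dilation preserves past support `{x⁰ < 0}`. [folklore] -/
theorem tsupport_dilateTest_subset_past {s : ℝ} (hs : 0 < s) {f : 𝓢(E4, ℝ)}
    (hf : tsupport (f : E4 → ℝ) ⊆ {y : E4 | y 0 < 0}) :
    tsupport ((dilateTest s hs.ne' f : 𝓢(E4, ℝ)) : E4 → ℝ) ⊆ {y : E4 | y 0 < 0} := by
  intro x hx
  have h := hf (tsupport_dilateTest_subset hs.ne' f hx)
  simp only [Set.mem_setOf_eq, PiLp.smul_apply, smul_eq_mul] at h
  simp only [Set.mem_setOf_eq]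
  by_contra hx0
  exact absurd h (not_lt.mpr (mul_nonneg (inv_pos.mpr hs).le (not_lt.mp hx0)))

/-- Dilation preserves disjointness of supports. [folklore] -/
theorem disjoint_tsupport_dilateTest {s : ℝ} (hs : s ≠ 0) {f g : 𝓢(E4, ℝ)}
    (hfg : Disjoint (tsupport (f : E4 → ℝ)) (tsupport (g : E4 → ℝ))) :
    Disjoint (tsupport ((dilateTest s hs f : 𝓢(E4, ℝ)) : E4 → ℝ))
      (tsupport ((dilateTest s hs g : 𝓢(E4, ℝ)) : E4 → ℝ)) :=
  Set.disjoint_of_subset (tsupport_dilateTest_subset hs f) (tsupport_dilateTest_subset hs g)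
    (hfg.preimage _)

end Admissible

/-! ## (a) Load-bearing analysis: the companion is idle at constant ratio -/

/-- **Constant-ratio companions are idle.** If `a'_k = C·a_k` (`C > 0`) with the same couplings and
volumes, UV extinction of `κ₃^canon` along `sch'` (at all admissible data) ALREADY gives extinction
along `sch` at all admissible data — with NO gap, NO window, NO weak coupling and NO `a ≤ a'` used.
Hence every bit of content of K2 sits in the regime `a_k / a'_k → 0` (non-uniformity of the
extinction under unbounded dilations). [folklore] -/
theorem tendsto_cruxKappa3_of_constRatio (r : LatticeRep G)
    {sch sch' : SpeciesScheme (YMSpecies G)} (hβ : sch'.β = sch.β) (hL : sch'.L = sch.L)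
    {C : ℝ} (hC : 0 < C) (hratio : ∀ k, sch'.a k = C * sch.a k)
    (hext : ∀ (u' f g h : 𝓢(E4, ℝ)), HasCompactSupport (u' : E4 → ℝ) →
      tsupport (u' : E4 → ℝ) ⊆ {y : E4 | y 0 < 0} → HasCompactSupport (f : E4 → ℝ) →
      HasCompactSupport (g : E4 → ℝ) → HasCompactSupport (h : E4 → ℝ) →
      Disjoint (tsupport (f : E4 → ℝ)) (tsupport (g : E4 → ℝ)) →
      Disjoint (tsupport (f : E4 → ℝ)) (tsupport (h : E4 → ℝ)) →
      Disjoint (tsupport (g : E4 → ℝ)) (tsupport (h : E4 → ℝ)) →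
      Tendsto (cruxKappa3 r sch' u' f g h) atTop (𝓝 0))
    {u f g h : 𝓢(E4, ℝ)} (hu : HasCompactSupport (u : E4 → ℝ))
    (hup : tsupport (u : E4 → ℝ) ⊆ {y : E4 | y 0 < 0}) (hf : HasCompactSupport (f : E4 → ℝ))
    (hg : HasCompactSupport (g : E4 → ℝ)) (hh : HasCompactSupport (h : E4 → ℝ))
    (hfg : Disjoint (tsupport (f : E4 → ℝ)) (tsupport (g : E4 → ℝ)))
    (hfh : Disjoint (tsupport (f : E4 → ℝ)) (tsupport (h : E4 → ℝ)))
    (hgh : Disjoint (tsupport (g : E4 → ℝ)) (tsupport (h : E4 → ℝ))) :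
    Tendsto (cruxKappa3 r sch u f g h) atTop (𝓝 0) := by
  have key : cruxKappa3 r sch u f g h = cruxKappa3 r sch' (dilateTest C hC.ne' u)
      (dilateTest C hC.ne' f) (dilateTest C hC.ne' g) (dilateTest C hC.ne' h) :=
    funext fun k => cruxKappa3_companion r hβ hL k hC.ne' (hratio k) u f g h
  rw [key]
  exact hext _ _ _ _ (hasCompactSupport_dilateTest hC.ne' hu)
    (tsupport_dilateTest_subset_past hC hup) (hasCompactSupport_dilateTest hC.ne' hf)
    (hasCompactSupport_dilateTest hC.ne' hg) (hasCompactSupport_dilateTest hC.ne' hh)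
    (disjoint_tsupport_dilateTest hC.ne' hfg) (disjoint_tsupport_dilateTest hC.ne' hfh)
    (disjoint_tsupport_dilateTest hC.ne' hgh)

/-! ## (b) Boundary lemma: collapse of the self-normalisation at `T_k(u) ≤ 0` -/

/-- When `T_k(u) ≤ 0` the canonical constant `c_k = (√T_k)⁻¹` is `0` and every self-normalised
`n`-point function (`n ≥ 1`) vanishes at step `k`. [folklore] -/
theorem latticeSchwinger_cruxCanon_eq_zero_of_cruxT_nonpos (r : LatticeRep G)
    (sch : SpeciesScheme (YMSpecies G)) (u : 𝓢(E4, ℝ)) {k : ℕ} (hT : cruxT r sch u k ≤ 0)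
    {n : ℕ} (hn : n ≠ 0) (f : Fin n → 𝓢(E4, ℝ)) :
    latticeSchwinger r.ρ (cruxCanon r sch u) (fun s => s.F) k n (fun _ => r.curvature) f = 0 := by
  have hc : (Real.sqrt (cruxT r sch u k))⁻¹ = 0 := by
    rw [Real.sqrt_eq_zero'.mpr hT, inv_zero]
  unfold latticeSchwinger cruxCanon
  simp only [hc, smearedLatticeField_zero_const, Finset.prod_const, Finset.card_univ,
    Fintype.card_fin, zero_pow hn, integral_zero]

/-- **Collapse**: `T_k(u) ≤ 0 ⇒ κ₃^canon_k(u; f, g, h) = 0`.  So the CONCLUSION of K2 holds for free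
along any `k`-subsequence where the window function's two-point function is not positive — a
counterexample must keep `T_k(u) > 0` (cf. the plan's `stub_twoPointMaxwellLower`). [folklore] -/
theorem cruxKappa3_eq_zero_of_cruxT_nonpos (r : LatticeRep G) (sch : SpeciesScheme (YMSpecies G))
    (u f g h : 𝓢(E4, ℝ)) {k : ℕ} (hT : cruxT r sch u k ≤ 0) : cruxKappa3 r sch u f g h k = 0 := by
  unfold cruxKappa3
  simp only [latticeSchwinger_cruxCanon_eq_zero_of_cruxT_nonpos r sch u hT (by decide : (3:ℕ) ≠ 0),
    latticeSchwinger_cruxCanon_eq_zero_of_cruxT_nonpos r sch u hT (by decide : (2:ℕ) ≠ 0),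
    latticeSchwinger_cruxCanon_eq_zero_of_cruxT_nonpos r sch u hT (by decide : (1:ℕ) ≠ 0)]
  ring

/-- Eventual collapse: `T_k(u) ≤ 0` eventually ⇒ `κ₃^canon_k → 0` (trivially). [folklore] -/
theorem tendsto_cruxKappa3_of_eventually_cruxT_nonpos (r : LatticeRep G)
    (sch : SpeciesScheme (YMSpecies G)) (u f g h : 𝓢(E4, ℝ))
    (hT : ∀ᶠ k in atTop, cruxT r sch u k ≤ 0) : Tendsto (cruxKappa3 r sch u f g h) atTop (𝓝 0) :=
  tendsto_const_nhds.congr'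
    (hT.mono fun _ hk => (cruxKappa3_eq_zero_of_cruxT_nonpos r sch u f g h hk).symm)

end Summit.QuantumFields.YangMills.Theorems.SkewnessNonGeneration.Negative

end
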